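import Mathlib

/-!
# Crux `RtdLocal` (stmt-ResolutionOfSingularities-18840), line `Sketch` — stub `stub_arcEquiv`

Arc bijection along a localisation.  Let `B ⊆ K` be a `k`-subalgebra of a field, `s ∈ B`
nonzero, `B' := Algebra.adjoin k (B ∪ {s⁻¹}) = B[s⁻¹] ⊆ K`, `incl : B →ₐ[k] B'` the inclusion,
`m'` an ideal of `B'` and `m := m' ∩ B` (`Ideal.comap incl`).  An *arc* is a `k`-algebra map
into the Hahn field `k⟦t^ℚ⟧ = HahnSeries ℚ k` sending the ideal to series of positive order.
If `s ≡ c (mod m)` for a nonzero constant `c`, restriction `α' ↦ α' ∘ incl` is a bijection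
between the arcs of `B'` centred at `m'` and the arcs of `B` centred at `m`; we package it as an
`Equiv` `e` from the latter to the former with `(e a) ∘ incl = a`.

Proof.  `B'` is the localisation of `B` away from `s` (`IsLocalization.Away`, checked by hand
from the description `B' = {b / s ^ e | b ∈ B}` obtained by `Algebra.adjoin_induction`).  An
arc `a` centred at `m` sends `s = (s - c) + c` to a series of order `0`, hence to a unit, so it
extends uniquely to `B'` (`IsLocalization.liftAlgHom`, `IsLocalization.ringHom_ext`); the
extension is centred at `m'` because `x' = b / s ^ e ∈ m'` forces `b = x' s ^ e ∈ m' ∩ B` and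
`ord (a s) ^ e = 0`.  (Argument adapted from `resEquiv` in the idea file
`Cruxes/RtdLocal/Lines/cotangent_shadow.lean`.)
-/

set_option linter.dupNamespace false

namespace Summit.ResolutionOfSingularities.ResolutionOfSingularities.Theorems

section ArcEquivHelpers

variable {k K : Type} [Field k] [Field K] [Algebra k K]

/-- Bridge: the `algebraMap k k⟦t^ℚ⟧` synthesised by Mathlib (through power series) is the
constant embedding `HahnSeries.C`. -/
theorem arcEquiv_algebraMap_eq_C (a : k) :
    algebraMap k (HahnSeries ℚ k) a = HahnSeries.C a := by
  first
  | rfl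
  | (rw [HahnSeries.algebraMap_apply', ← PowerSeries.C_eq_algebraMap,
      HahnSeries.ofPowerSeries_C])

/-- A Hahn series of order `0` has all its powers of order `0`. -/
theorem arcEquiv_orderTop_pow_eq_zero {x : HahnSeries ℚ k} (hx : x.orderTop = 0) (e : ℕ) :
    (x ^ e).orderTop = 0 := by
  induction e with
  | zero => simp
  | succ e ih => rw [pow_succ, HahnSeries.orderTop_mul, ih, hx, add_zero]

/-- A Hahn series of order `0` is a unit of the Hahn field. -/
theorem arcEquiv_isUnit_of_orderTop_eq_zero {x : HahnSeries ℚ k} (hx : x.orderTop = 0) :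
    IsUnit x := by
  rw [isUnit_iff_ne_zero]
  rintro rfl
  rw [HahnSeries.orderTop_zero] at hx
  exact WithTop.top_ne_coe hx

/-- An arc of `B` centred at an ideal `m` with `s ≡ c ≢ 0 (mod m)` sends `s` to a series of
order `0`. -/
theorem arcEquiv_orderTop_eq_zero {B : Subalgebra k K} {s : K} (hs : s ∈ B) {m : Ideal ↥B}
    (α : ↥B →ₐ[k] HahnSeries ℚ k) (hα : ∀ x ∈ m, 0 < (α x).orderTop) {c : k} (hc0 : c ≠ 0)
    (hc : (⟨s, hs⟩ : ↥B) - algebraMap k ↥B c ∈ m) : (α ⟨s, hs⟩).orderTop = 0 := by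
  have hsplit : α ⟨s, hs⟩ = α (⟨s, hs⟩ - algebraMap k ↥B c) + HahnSeries.C c := by
    rw [map_sub, AlgHom.commutes, arcEquiv_algebraMap_eq_C]
    ring
  have hC : (HahnSeries.C c : HahnSeries ℚ k).orderTop = 0 := by
    rw [HahnSeries.C_apply, HahnSeries.orderTop_single hc0]
    rfl
  rw [hsplit, HahnSeries.orderTop_add_eq_right (by rw [hC]; exact hα _ hc), hC]

/-- Elements of `B[s⁻¹] = adjoin k (B ∪ {s⁻¹})` are the fractions `b * (s ^ e)⁻¹`, `b ∈ B`. -/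
theorem arcEquiv_exists_of_mem_adjoin {B : Subalgebra k K} {s : K} (hs : s ∈ B) (hs0 : s ≠ 0)
    {z : K} (hz : z ∈ Algebra.adjoin k ((B : Set K) ∪ {s⁻¹})) :
    ∃ b ∈ B, ∃ e : ℕ, z = b * (s ^ e)⁻¹ := by
  refine Algebra.adjoin_induction ?_ ?_ ?_ ?_ hz
  · rintro x (hx | hx)
    · exact ⟨x, hx, 0, by simp⟩
    · rw [Set.mem_singleton_iff] at hx
      subst hx
      exact ⟨1, B.one_mem, 1, by simp⟩
  · intro c
    exact ⟨algebraMap k K c, B.algebraMap_mem c, 0, by simp⟩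
  · rintro x y - - ⟨b₁, hb₁, e₁, rfl⟩ ⟨b₂, hb₂, e₂, rfl⟩
    refine ⟨b₁ * s ^ e₂ + b₂ * s ^ e₁,
      B.add_mem (B.mul_mem hb₁ (B.pow_mem hs _)) (B.mul_mem hb₂ (B.pow_mem hs _)), e₁ + e₂, ?_⟩
    field_simp
    ring
  · rintro x y - - ⟨b₁, hb₁, e₁, rfl⟩ ⟨b₂, hb₂, e₂, rfl⟩
    refine ⟨b₁ * b₂, B.mul_mem hb₁ hb₂, e₁ + e₂, ?_⟩
    field_simp
    ring

/-- `B[s⁻¹] = adjoin k (B ∪ {s⁻¹})` is the localisation of `B` away from `s`, for the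
`B`-algebra structure given by the inclusion. -/
theorem arcEquiv_isLocalization {B : Subalgebra k K} {s : K} (hs : s ∈ B) (hs0 : s ≠ 0)
    (hle : B ≤ Algebra.adjoin k ((B : Set K) ∪ {s⁻¹})) :
    letI := (Subalgebra.inclusion hle).toRingHom.toAlgebra
    IsLocalization.Away (⟨s, hs⟩ : ↥B) ↥(Algebra.adjoin k ((B : Set K) ∪ {s⁻¹})) := by
  letI := (Subalgebra.inclusion hle).toRingHom.toAlgebra
  have halg : ∀ b : ↥B, algebraMap ↥B ↥(Algebra.adjoin k ((B : Set K) ∪ {s⁻¹})) b =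
      Subalgebra.inclusion hle b := fun _ => rfl
  have hunit : IsUnit (Subalgebra.inclusion hle ⟨s, hs⟩) := by
    refine IsUnit.of_mul_eq_one
      ⟨s⁻¹, Algebra.subset_adjoin (Set.mem_union_right _ rfl)⟩ (Subtype.ext ?_)
    simp [mul_inv_cancel₀ hs0]
  refine ⟨?_, ?_, ?_⟩
  · rintro ⟨y, e, rfl⟩
    rw [halg, map_pow]
    exact hunit.pow e
  · intro z
    obtain ⟨b, hb, e, hz⟩ := arcEquiv_exists_of_mem_adjoin hs hs0 z.2
    refine ⟨(⟨b, hb⟩, ⟨⟨s, hs⟩ ^ e, e, rfl⟩), Subtype.ext ?_⟩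
    simp only [halg, map_pow, Subalgebra.coe_mul, Subalgebra.coe_pow, Subalgebra.coe_inclusion]
    rw [hz, inv_mul_cancel_right₀ (pow_ne_zero e hs0)]
  · intro x y hxy
    refine ⟨1, ?_⟩
    rw [halg, halg] at hxy
    have := Subalgebra.inclusion_injective hle hxy
    simp [this]

/-- The arc bijection for an abstract intermediate localisation `B ≤ B'` of `B` away from
`s ∈ B` inside `K`: if `s ≡ c ≢ 0` modulo `m := m' ∩ B`, every arc of `B` centred at `m` extends
uniquely to an arc of `B'` centred at `m'`. -/
theorem arcEquiv_of_isLocalization {B B' : Subalgebra k K} (hle : B ≤ B') {s : K} (hs : s ∈ B)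
    (hloc : letI := (Subalgebra.inclusion hle).toRingHom.toAlgebra
      IsLocalization.Away (⟨s, hs⟩ : ↥B) ↥B')
    (m' : Ideal ↥B') {c : k} (hc0 : c ≠ 0)
    (hc : (⟨s, hs⟩ : ↥B) - algebraMap k ↥B c ∈ m'.comap (Subalgebra.inclusion hle)) :
    ∃ e : {α : ↥B →ₐ[k] HahnSeries ℚ k //
            ∀ x ∈ m'.comap (Subalgebra.inclusion hle), 0 < (α x).orderTop} ≃
          {α : ↥B' →ₐ[k] HahnSeries ℚ k // ∀ x ∈ m', 0 < (α x).orderTop},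
      ∀ a (x : ↥B), (e a).1 (Subalgebra.inclusion hle x) = a.1 x := by
  letI instAlg : Algebra ↥B ↥B' := (Subalgebra.inclusion hle).toRingHom.toAlgebra
  haveI instTower : IsScalarTower k ↥B ↥B' := IsScalarTower.of_algebraMap_eq fun _ => rfl
  haveI instLoc : IsLocalization.Away (⟨s, hs⟩ : ↥B) ↥B' := hloc
  have halg : ∀ b : ↥B, algebraMap ↥B ↥B' b = Subalgebra.inclusion hle b := fun _ => rfl
  -- every arc centred at `m` inverts the powers of `s`
  have hunits : ∀ a : {α : ↥B →ₐ[k] HahnSeries ℚ k //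
      ∀ x ∈ m'.comap (Subalgebra.inclusion hle), 0 < (α x).orderTop},
      ∀ y : Submonoid.powers (⟨s, hs⟩ : ↥B), IsUnit (a.1 y) := by
    rintro a ⟨y, e, rfl⟩
    rw [map_pow]
    exact (arcEquiv_isUnit_of_orderTop_eq_zero
      (arcEquiv_orderTop_eq_zero hs a.1 a.2 hc0 hc)).pow e
  -- the extension `IsLocalization.liftAlgHom (hunits a)` restricts to `a`
  have hext : ∀ a (x : ↥B),
      (IsLocalization.liftAlgHom (hunits a) : ↥B' →ₐ[k] HahnSeries ℚ k)
        (Subalgebra.inclusion hle x) = a.1 x :=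
    fun a x => IsLocalization.lift_eq (hunits a) x
  -- the extension is centred at `m'`
  have hcent : ∀ a, ∀ z ∈ m',
      0 < ((IsLocalization.liftAlgHom (hunits a) : ↥B' →ₐ[k] HahnSeries ℚ k) z).orderTop := by
    intro a z hz
    obtain ⟨⟨b, y, e, rfl⟩, hz'⟩ := IsLocalization.surj (Submonoid.powers (⟨s, hs⟩ : ↥B)) z
    simp only [halg, map_pow] at hz'
    have hbm : b ∈ m'.comap (Subalgebra.inclusion hle) := by
      rw [Ideal.mem_comap, ← hz']
      exact m'.mul_mem_right _ hz
    have hval := congrArg (IsLocalization.liftAlgHom (hunits a) : ↥B' →ₐ[k] HahnSeries ℚ k) hz'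
    rw [map_mul, map_pow, hext, hext] at hval
    have hord := congrArg HahnSeries.orderTop hval
    rw [HahnSeries.orderTop_mul,
      arcEquiv_orderTop_pow_eq_zero (arcEquiv_orderTop_eq_zero hs a.1 a.2 hc0 hc), add_zero]
      at hord
    rw [hord]
    exact a.2 b hbm
  refine ⟨⟨fun a => ⟨IsLocalization.liftAlgHom (hunits a), hcent a⟩,
    fun a' => ⟨a'.1.comp (Subalgebra.inclusion hle), fun x hx => a'.2 _ hx⟩,
    fun a => ?_, fun a' => ?_⟩, fun a x => hext a x⟩
  · -- restricting the extension gives back `a`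
    apply Subtype.ext
    apply AlgHom.ext
    intro x
    exact hext a x
  · -- two arcs of `B'` that agree on `B` agree (`B'` is a localisation of `B`)
    apply Subtype.ext
    apply AlgHom.coe_ringHom_injective
    refine IsLocalization.ringHom_ext (Submonoid.powers (⟨s, hs⟩ : ↥B)) (RingHom.ext fun x => ?_)
    exact hext ⟨a'.1.comp (Subalgebra.inclusion hle), fun x hx => a'.2 _ hx⟩ x

end ArcEquivHelpers

/-- **Arc bijection along `B ⊆ B[s⁻¹]`** (stub `stub_arcEquiv` of crux `RtdLocal`, line
`Sketch`): with `B' = adjoin k (B ∪ {s⁻¹})`, `m'` an ideal of `B'` and `s ≡ c ≢ 0` modulo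
`m := m' ∩ B`, restriction is a bijection between the arcs `B' →ₐ[k] k⟦t^ℚ⟧` centred at `m'`
and the arcs `B →ₐ[k] k⟦t^ℚ⟧` centred at `m`; `e` is its inverse, `(e a) ∘ incl = a`. -/
theorem stub_arcEquiv {k K : Type} [Field k] [Field K] [Algebra k K]
    (B : Subalgebra k K) (s : K) (hs : s ∈ B) (hs0 : s ≠ 0)
    (hle : B ≤ Algebra.adjoin k ((B : Set K) ∪ {s⁻¹}))
    (m' : Ideal ↥(Algebra.adjoin k ((B : Set K) ∪ {s⁻¹})))
    (c : k) (hc0 : c ≠ 0)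
    (hc : (⟨s, hs⟩ : ↥B) - algebraMap k ↥B c ∈ m'.comap (Subalgebra.inclusion hle)) :
    ∃ e : {α : ↥B →ₐ[k] HahnSeries ℚ k //
            ∀ x ∈ m'.comap (Subalgebra.inclusion hle), 0 < (α x).orderTop} ≃
          {α : ↥(Algebra.adjoin k ((B : Set K) ∪ {s⁻¹})) →ₐ[k] HahnSeries ℚ k //
            ∀ x ∈ m', 0 < (α x).orderTop},
      ∀ a (x : ↥B), (e a).1 (Subalgebra.inclusion hle x) = a.1 x :=
  arcEquiv_of_isLocalization hle hs (arcEquiv_isLocalization hs hs0 hle) m' hc0 hc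

end Summit.ResolutionOfSingularities.ResolutionOfSingularities.Theorems
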